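import Literature.NumberTheory.Automorphic.ReciprocityGLnProofs
import Literature.NumberTheory.Automorphic.AutomorphicRepsGLSatakeFlathProofs
import Literature.NumberTheory.Automorphic.BigCellOpen
import Literature.NumberTheory.GaloisRepresentations.ArtinRestriction
import Literature.NumberTheory.GaloisRepresentations.FrobeniusPlaces
import HarnessLib

/-!
# Unramified local–global compatibility under restriction to `Γ_L` and base change
# (the Galois side of Arthur–Clozel's relation `c(Π_w) = c(π_v)^{f(w|v)}`, rank `n`)

Topic `Literature/NumberTheory/Automorphic`.  A *proofs* file (theorems only: no definition, no
named fact) next to `ReciprocityGLnProofs`, written by the tenured seat of the named fact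
`Literature.NumberTheory.Automorphic.HarrisLanTaylorThorne2016.theoremA_existence`
(Harris–Lan–Taylor–Thorne 2016, Thm. A = Cor. 7.14, existence).  Its printed proof (p. 232:
"This can be deduced from Theorem 7.13 by using lemma 1 of [54]. (This is the same argument
used in the proof of theorem VII.1.9 of [29].)") base-changes `π` from `E` to the CM fields
`F_A = E·A`, `A` imaginary quadratic, takes `r_A = r_{p,ı}(BC_{F_A/E}(π))` from Thm. 7.13, and
patches the `r_A` along Sorensen's patching lemma; the two hypotheses of that lemma
(`r_A^σ ≅ r_A`, `r_A|_{Γ_{F_AF_{A'}}} ≅ r_{A'}|_{Γ_{F_AF_{A'}}}`, Harris–Taylor p. 230: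
"It follows from the Cebotarev density theorem that …") are read off, by Chebotarev and
Brauer–Nesbitt, from the characteristic polynomials of Frobenius of the *restricted*
representations at the places of the bigger field, which are those predicted by the Satake
parameters of the base change.  This file proves that bookkeeping in rank `n`, in the
vocabulary of `ReciprocityGLn`/`ReciprocityGLnProofs` (`arithFrobPolyOfSatake`,
`IsGaloisCompatibleAt`) and of the Galois-representation files (`FramedGaloisRep.restrictField`,
`IsUnramifiedAt`, `HasFrobCharpolyAt`):

* `Literature.NumberTheory.Automorphic.LinearMap.roots_charpoly_pow`,
  `Literature.NumberTheory.Automorphic.Matrix.roots_charpoly_pow` — over an algebraically closed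
  field, the roots of `χ_{f^m}` are the `m`-th powers of the roots of `χ_f`, with multiplicity
  (generalised eigenspaces: `V_μ(f) ≤ V_{μ^m}(f^m)` and a dimension count); hence, over any
  field, `Literature.NumberTheory.Automorphic.Matrix.charpoly_pow_eq_prod_of_charpoly_eq_prod`:
  `χ_M = ∏_{a ∈ s} (X - a) ⟹ χ_{M^m} = ∏_{a ∈ s} (X - a^m)` — the rank-`n` version of the tree's
  `Matrix.charpoly_pow_eq_of_charpoly_eq_fin_two` (`GaloisRepresentations/ArtinRestriction`).
* `Literature.NumberTheory.GaloisRepresentations.FramedGaloisRep.hasFrobCharpolyAt_restrictField`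
  — **Frobenius characteristic polynomials under restriction, rank `n`**: if `σ : Γ_F → GL_n(k)`
  is unramified at `v` with `charpoly σ(Frob_v) = ∏_{a ∈ s} (X - a)`, then for every place
  `w ∣ v` of `E`, `charpoly σ|_{Γ_E}(Frob_w) = ∏_{a ∈ s} (X - a^{f(w|v)})` (the rank-`2` case is
  `FramedGaloisRep.hasFrobCharpolyAt_restrictField_fin_two` of `ArtinRestriction`).
* `Literature.NumberTheory.Automorphic.arithFrobPolyOfSatake_pow` — the predicted polynomial
  transforms the same way: `arithFrobPolyOfSatake ı (q^f) m (α^f) = ∏_{b} (X - b^f)`, `b` over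
  the roots of `arithFrobPolyOfSatake ı q m α` (`√(q^f) = (√q)^f`).
* `Literature.NumberTheory.Automorphic.hasFrobCharpolyAt_restrictField_arithFrobPolyOfSatake`,
  `Literature.NumberTheory.Automorphic.isGaloisCompatibleAt_restrictField` — **assembly**: if
  `r : Γ_K → GL_n(ℚ̄_ℓ)` is compatible with `π` at `v` (`IsGaloisCompatibleAt π ı r v`:
  unramified, arithmetic-Frobenius characteristic polynomial `arithFrobPolyOfSatake ı q_v n α`
  for the Satake parameter `α` of `π_v`) and `Π` (on `GL_n(𝔸_L)`, `L ⊇ K`) has Satake parameter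
  `α^{f(w|v)}` at the place `w ∣ v` — Arthur–Clozel's relation (1.1) for a base-change lift,
  `exists_baseChange_cyclic` of `BaseChangeGLn` — then `r|_{Γ_L}` is compatible with `Π` at `w`
  (`q_w = q_v^{f(w|v)}`, uniqueness of Satake parameters
  `AutomorphicRepData.hasSatakeParamAt_unique_holds`).

Everything here is proved; nothing is asserted about the existence of base change or of the
representations (those are the named facts `exists_baseChange_cyclic`, `theoremA_existence`).

## References

* M. Harris, K.-W. Lan, R. Taylor, J. Thorne, *On the rigid cohomology of certain Shimura
  varieties*, Res. Math. Sci. 3:37 (2016), Cor. 7.14 and its proof (p. 232).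
  [HarrisLanTaylorThorneRMS2016]
* M. Harris, R. Taylor, *The geometry and cohomology of some simple Shimura varieties*, Ann. of
  Math. Stud. 151 (2001), proof of Thm. VII.1.9 (pp. 228–231). [HarrisTaylor2001]
* J. Arthur, L. Clozel, *Simple algebras, base change, and the advanced theory of the trace
  formula*, Ann. of Math. Stud. 120 (1989), Ch. 3, §1, (1.1) and Def. 1.1. [ArthurClozel1989]
* J. Neukirch, *Algebraic Number Theory* (1999), Ch. I §8–§9 (residue degrees, Frobenius).
  [NeukirchANT1999]
-/

noncomputable section

open scoped MatrixGroups Matrix Classical Polynomial NumberField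
open NumberField IsDedekindDomain Field Polynomial Module Module.End

namespace Literature.NumberTheory.Automorphic

/-! ## Roots of the characteristic polynomial of a power -/

section LinearAlgebra

variable {K : Type*} [Field K] {V : Type*} [AddCommGroup V] [Module K V]

/-- **`V_μ(f) ≤ V_{μ^m}(f^m)`**: the generalised `μ`-eigenspace of `f` lies in the generalised
`μ^m`-eigenspace of `f^m`, because `X^m - μ^m = (X - μ) q(X)` in `K[X]`, so that
`(f^m - μ^m)^k = q(f)^k (f - μ)^k` kills whatever `(f - μ)^k` kills.
Bourbaki, *Algèbre*, Ch. VII §5. [folklore] -/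
theorem LinearMap.maxGenEigenspace_le_maxGenEigenspace_pow (f : End K V) (μ : K) (m : ℕ) :
    f.maxGenEigenspace μ ≤ (f ^ m).maxGenEigenspace (μ ^ m) := by
  intro x hx
  rw [Module.End.mem_maxGenEigenspace] at hx ⊢
  obtain ⟨k, hk⟩ := hx
  obtain ⟨q, hq⟩ := sub_dvd_pow_sub_pow (X : K[X]) (C μ) m
  refine ⟨k, ?_⟩
  have h1 : f - μ • (1 : End K V) = aeval f (X - C μ) := by
    simp [Algebra.algebraMap_eq_smul_one]
  have h2 : f ^ m - (μ ^ m) • (1 : End K V) = aeval f ((X - C μ) * q) := by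
    rw [← hq]
    simp [Algebra.algebraMap_eq_smul_one, _root_.smul_pow]
  have h3 : (f ^ m - (μ ^ m) • (1 : End K V)) ^ k =
      aeval f (q ^ k) * (f - μ • (1 : End K V)) ^ k := by
    rw [h2, ← map_pow, mul_pow, mul_comm, map_mul, map_pow (aeval f) (X - C μ), ← h1]
  rw [h3, Module.End.mul_apply, hk, map_zero]

/-- Over any field: the sum of the multiplicities of the roots of a non-zero polynomial is the
number of its roots counted with multiplicity (Mathlib `Polynomial.count_roots`,
`Multiset.toFinset_sum_count_eq`). [folklore] -/
theorem sum_rootMultiplicity_eq_card_roots (p : K[X]) :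
    ∑ μ ∈ p.roots.toFinset, p.rootMultiplicity μ = Multiset.card p.roots := by
  classical
  simp_rw [← Polynomial.count_roots]
  exact Multiset.toFinset_sum_count_eq _

/-- `card (s.filter P) = Σ_{a ∈ s.toFinset, P a} count a s`. [folklore] -/
theorem card_filter_eq_sum_count {τ : Type*} [DecidableEq τ] (s : Multiset τ) (P : τ → Prop)
    [DecidablePred P] :
    Multiset.card (s.filter P) = ∑ a ∈ s.toFinset with P a, s.count a := by
  rw [← Multiset.toFinset_sum_count_eq, Multiset.toFinset_filter]
  refine Finset.sum_congr rfl fun a ha ↦ ?_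
  rw [Finset.mem_filter] at ha
  exact Multiset.count_filter_of_pos ha.2

variable [IsAlgClosed K] [FiniteDimensional K V]

/-- **Multiplicities of the roots of `χ_{f^m}`** (algebraically closed field): the multiplicity
of `ν` as a root of the characteristic polynomial of `f^m` is the sum of the multiplicities of
the roots `μ` of `χ_f` with `μ^m = ν`.  Proof: `mult_μ(χ_f) = dim V_μ(f)` (Mathlib
`LinearMap.finrank_maxGenEigenspace_eq`), the `V_μ(f)` are independent (so the dimension of a
finite sum of them is the sum of the dimensions, the tree's `finrank_biSup_eq_sum_of_iSupIndep'`
of `BigCellOpen`) and `⊕_{μ^m = ν} V_μ(f) ≤ V_ν(f^m)` (`maxGenEigenspace_le_maxGenEigenspace_pow`),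
which gives `≤`; both sides sum to `dim V` over `ν`, whence equality.
Bourbaki, *Algèbre*, Ch. VII §5, no. 5. [folklore] -/
theorem LinearMap.rootMultiplicity_charpoly_pow (f : End K V) (m : ℕ) (ν : K) :
    (f ^ m).charpoly.rootMultiplicity ν =
      ∑ μ ∈ f.charpoly.roots.toFinset with μ ^ m = ν, f.charpoly.rootMultiplicity μ := by
  classical
  set g : End K V := f ^ m with hg
  set T : Finset K := f.charpoly.roots.toFinset with hT
  set T' : Finset K := g.charpoly.roots.toFinset with hT'
  -- `A ν ≤ B ν`
  have hle : ∀ ν : K, ∑ μ ∈ T with μ ^ m = ν, f.charpoly.rootMultiplicity μ ≤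
      g.charpoly.rootMultiplicity ν := by
    intro ν
    calc ∑ μ ∈ T with μ ^ m = ν, f.charpoly.rootMultiplicity μ
        = ∑ μ ∈ T with μ ^ m = ν, Module.finrank K (f.maxGenEigenspace μ) := by
          refine Finset.sum_congr rfl fun μ _ ↦ ?_
          rw [LinearMap.finrank_maxGenEigenspace_eq]
      _ = Module.finrank K ↥(⨆ μ ∈ T.filter (fun μ ↦ μ ^ m = ν), f.maxGenEigenspace μ) :=
          (finrank_biSup_eq_sum_of_iSupIndep' f.independent_maxGenEigenspace _).symm
      _ ≤ Module.finrank K (g.maxGenEigenspace ν) := by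
          refine Submodule.finrank_mono (iSup₂_le fun μ hμ ↦ ?_)
          rw [Finset.mem_filter] at hμ
          rw [← hμ.2]
          exact LinearMap.maxGenEigenspace_le_maxGenEigenspace_pow f μ m
      _ = g.charpoly.rootMultiplicity ν := LinearMap.finrank_maxGenEigenspace_eq _ _
  -- totals: both families sum to `dim V`
  have htot : ∀ h : End K V, ∑ μ ∈ h.charpoly.roots.toFinset, h.charpoly.rootMultiplicity μ =
      Module.finrank K V := by
    intro h
    rw [sum_rootMultiplicity_eq_card_roots, IsAlgClosed.card_roots_eq_natDegree,
      LinearMap.charpoly_natDegree]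
  set U : Finset K := T' ∪ T.image (fun μ ↦ μ ^ m) with hU
  have hmaps : ∀ μ ∈ T, μ ^ m ∈ U := fun μ hμ ↦
    Finset.mem_union_right _ (Finset.mem_image_of_mem _ hμ)
  have hsumA : ∑ ν ∈ U, ∑ μ ∈ T with μ ^ m = ν, f.charpoly.rootMultiplicity μ =
      Module.finrank K V := by
    rw [Finset.sum_fiberwise_of_maps_to hmaps, htot f]
  have hB0 : ∀ ν ∉ T', g.charpoly.rootMultiplicity ν = 0 := by
    intro ν hν
    refine Polynomial.rootMultiplicity_eq_zero fun hr ↦ hν ?_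
    rw [hT', Multiset.mem_toFinset, mem_roots g.charpoly_monic.ne_zero]
    exact hr
  have hsumB : ∑ ν ∈ U, g.charpoly.rootMultiplicity ν = Module.finrank K V := by
    rw [← htot g, eq_comm]
    exact Finset.sum_subset Finset.subset_union_left fun ν _ hν ↦ hB0 ν hν
  have hEq := (Finset.sum_eq_sum_iff_of_le fun ν _ ↦ hle ν).mp (hsumA.trans hsumB.symm)
  by_cases hνU : ν ∈ U
  · exact (hEq ν hνU).symm
  · -- off `U` both sides vanish
    have hA0 : ∑ μ ∈ T with μ ^ m = ν, f.charpoly.rootMultiplicity μ = 0 := by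
      refine Finset.sum_eq_zero fun μ hμ ↦ ?_
      rw [Finset.mem_filter] at hμ
      exact absurd (hμ.2 ▸ hmaps μ hμ.1) hνU
    rw [hA0]
    exact hB0 ν fun h ↦ hνU (Finset.mem_union_left _ h)

/-- **Roots of the characteristic polynomial of a power** (algebraically closed field): the
roots of `χ_{f^m}`, with multiplicity, are the `m`-th powers of the roots of `χ_f`.
Bourbaki, *Algèbre*, Ch. VII §5, no. 5. [folklore] -/
theorem LinearMap.roots_charpoly_pow (f : End K V) (m : ℕ) :
    (f ^ m).charpoly.roots = f.charpoly.roots.map (· ^ m) := by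
  classical
  ext ν
  rw [Polynomial.count_roots, LinearMap.rootMultiplicity_charpoly_pow, Multiset.count_map,
    card_filter_eq_sum_count]
  simp_rw [← Polynomial.count_roots]
  refine Finset.sum_congr ?_ fun _ _ ↦ rfl
  ext μ
  simp only [Finset.mem_filter, eq_comm]

/-- Matrix form of `LinearMap.roots_charpoly_pow` (Mathlib `Matrix.charpoly_toLin'`).
[folklore] -/
theorem Matrix.roots_charpoly_pow {ι : Type*} [Fintype ι] [DecidableEq ι] (M : Matrix ι ι K)
    (m : ℕ) : (M ^ m).charpoly.roots = M.charpoly.roots.map (· ^ m) := by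
  have h := LinearMap.roots_charpoly_pow (Matrix.toLin' M) m
  rwa [← Matrix.toLin'_pow, Matrix.charpoly_toLin', Matrix.charpoly_toLin'] at h

end LinearAlgebra

section AnyField

variable {k : Type*} [Field k]

/-- **`χ_M = ∏_{a ∈ s} (X - a) ⟹ χ_{M^m} = ∏_{a ∈ s} (X - a^m)`** for a square matrix over any
field (pass to an algebraic closure, where the monic `χ_{M^m}` is the product of `X - b` over its
roots, and use `Matrix.roots_charpoly_pow`).  The rank-`2` case is
`Matrix.charpoly_pow_eq_of_charpoly_eq_fin_two` of `GaloisRepresentations/ArtinRestriction`.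
Bourbaki, *Algèbre*, Ch. VII §5, no. 5. [folklore] -/
theorem Matrix.charpoly_pow_eq_prod_of_charpoly_eq_prod {ι : Type*} [Fintype ι] [DecidableEq ι]
    (M : Matrix ι ι k) {s : Multiset k} (h : M.charpoly = (s.map fun a ↦ X - C a).prod) (m : ℕ) :
    (M ^ m).charpoly = (s.map fun a ↦ X - C (a ^ m)).prod := by
  let K := AlgebraicClosure k
  let φ : k →+* K := algebraMap k K
  apply Polynomial.map_injective φ φ.injective
  have hM' : (M.map φ).charpoly = ((s.map φ).map fun a ↦ X - C a).prod := by
    rw [Matrix.charpoly_map, h, Polynomial.map_multiset_prod, Multiset.map_map, Multiset.map_map]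
    congr 1
    refine Multiset.map_congr rfl fun a _ ↦ ?_
    simp
  have hroots : ((M.map φ) ^ m).charpoly.roots = (s.map φ).map (· ^ m) := by
    rw [Matrix.roots_charpoly_pow, hM', roots_multiset_prod_X_sub_C]
  -- over `K̄` the monic `χ_{(M')^m}` is the product of `X - b` over its roots
  have hsplit : ((M.map φ) ^ m).charpoly =
      ((((M.map φ) ^ m).charpoly.roots).map fun a ↦ X - C a).prod :=
    (prod_multiset_X_sub_C_of_monic_of_roots_card_eq (Matrix.charpoly_monic _)
      (IsAlgClosed.card_roots_eq_natDegree)).symm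
  rw [← Matrix.charpoly_map, Matrix.map_pow, hsplit, hroots, Polynomial.map_multiset_prod,
    Multiset.map_map, Multiset.map_map, Multiset.map_map]
  congr 1
  refine Multiset.map_congr rfl fun a _ ↦ ?_
  simp

end AnyField

/-! ## Frobenius characteristic polynomials under restriction to `Γ_E`, rank `n` -/

section Restrict

variable {F E : Type*} [Field F] [NumberField F] [Field E] [NumberField E] [Algebra F E]
  {k : Type*} [Field k] [TopologicalSpace k] {n : ℕ}

/-- **Frobenius characteristic polynomials under restriction (rank `n`)**: if
`σ : Γ_F → GL_n(k)` is unramified at `v` with `charpoly σ(Frob_v) = ∏_{a ∈ s} (X - a)`, then for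
every place `w ∣ v` of `E`, `charpoly σ|_{Γ_E}(Frob_w) = ∏_{a ∈ s} (X - a^{f(w|v)})`
(`Frob_w ↦ Frob_v^{f(w|v)}` modulo inertia, `FramedGaloisRep.exists_restrictField_apply_eq_pow`,
and `Matrix.charpoly_pow_eq_prod_of_charpoly_eq_prod`).  This is the Galois-side counterpart of
the base-change relation `c(Π_w) = c(π_v)^{f(w|v)}` (Arthur–Clozel 1989, Ch. 3, (1.1)); the
rank-`2` case is `FramedGaloisRep.hasFrobCharpolyAt_restrictField_fin_two`.
Neukirch, *Algebraic Number Theory*, Ch. I §9; Serre 1968, Ch. I §2.1. [folklore] -/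
theorem _root_.Literature.NumberTheory.GaloisRepresentations.FramedGaloisRep.hasFrobCharpolyAt_restrictField
    (σ : GaloisRepresentations.FramedGaloisRep F k n)
    {v : HeightOneSpectrum (𝓞 F)} {w : HeightOneSpectrum (𝓞 E)}
    (hw : w.asIdeal.under (𝓞 F) = v.asIdeal) (hσ : σ.IsUnramifiedAt v) {s : Multiset k}
    (hP : σ.HasFrobCharpolyAt v ((s.map fun a ↦ X - C a).prod)) :
    (σ.restrictField E).HasFrobCharpolyAt w
      ((s.map fun a ↦ X - C (a ^ w.asIdeal.inertiaDeg (𝓞 F))).prod) := by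
  intro 𝔔 h𝔔 τ hτ
  obtain ⟨𝔓, h𝔓, φ, hφ, heq⟩ := σ.exists_restrictField_apply_eq_pow hw hσ h𝔔 hτ
  have hch : GaloisRepresentations.FramedRep.charpoly σ φ = (s.map fun a ↦ X - C a).prod :=
    hP 𝔓 h𝔓 φ hφ
  unfold GaloisRepresentations.FramedRep.charpoly at hch ⊢
  rw [heq, Units.val_pow_eq_pow_val]
  exact Matrix.charpoly_pow_eq_prod_of_charpoly_eq_prod _ hch _

end Restrict

/-! ## The predicted polynomial under `q ↦ q^f`, `α ↦ α^f` -/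

section Satake

variable {ℓ : ℕ} [Fact ℓ.Prime]

/-- `√(x^f) = (√x)^f` for `x ≥ 0`. [folklore] -/
theorem real_sqrt_pow {x : ℝ} (hx : 0 ≤ x) (f : ℕ) : Real.sqrt (x ^ f) = Real.sqrt x ^ f := by
  have h : x ^ f = (Real.sqrt x ^ f) ^ 2 := by
    rw [← pow_mul, mul_comm, pow_mul, Real.sq_sqrt hx]
  rw [h, Real.sqrt_sq (pow_nonneg (Real.sqrt_nonneg x) f)]

/-- **The Frobenius polynomial of a base-changed Satake parameter.**  For a residue cardinality
`q`, a residue degree `f` and a multiset `α`: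
`arithFrobPolyOfSatake ı (q^f) m (α^f) = ∏_b (X - b^f)`, the product over the roots `b` of
`arithFrobPolyOfSatake ı q m α` (the roots are `ı⁻¹((√q^{m-1} a)⁻¹)`, `a ∈ α`,
`roots_arithFrobPolyOfSatake`, and `√(q^f) = (√q)^f`).  With `q = q_v`, `f = f(w|v)` and `α`
the Satake parameter of `π_v`, the left side is the polynomial predicted at `w` for a
base-change lift (`c(Π_w) = c(π_v)^{f(w|v)}`, Arthur–Clozel 1989, Ch. 3, (1.1)) and the right
side is `charpoly r|_{Γ_L}(Frob_w)` (`FramedGaloisRep.hasFrobCharpolyAt_restrictField`).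
[folklore] -/
theorem arithFrobPolyOfSatake_pow (ι : PadicAlgCl ℓ ≃+* ℂ) (q m f : ℕ) (α : Multiset ℂ) :
    arithFrobPolyOfSatake ι (q ^ f) m (α.map (· ^ f)) =
      (((arithFrobPolyOfSatake ι q m α).roots.map (· ^ f)).map fun b ↦ X - C b).prod := by
  rw [roots_arithFrobPolyOfSatake, arithFrobPolyOfSatake, Multiset.map_map, Multiset.map_map,
    Multiset.map_map]
  congr 1
  refine Multiset.map_congr rfl fun a _ ↦ ?_
  have key : ((Real.sqrt ((q ^ f : ℕ) : ℝ) : ℝ) : ℂ) ^ (m - 1) * a ^ f =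
      ((((Real.sqrt (q : ℝ)) : ℝ) : ℂ) ^ (m - 1) * a) ^ f := by
    rw [Nat.cast_pow, real_sqrt_pow (Nat.cast_nonneg _) f, Complex.ofReal_pow, mul_pow, ← pow_mul,
      ← pow_mul, mul_comm f (m - 1)]
  show X - C (ι.symm ((((Real.sqrt ((q ^ f : ℕ) : ℝ) : ℝ) : ℂ) ^ (m - 1) * a ^ f)⁻¹)) =
    X - C ((ι.symm ((((Real.sqrt (q : ℝ) : ℝ) : ℂ) ^ (m - 1) * a)⁻¹)) ^ f)
  rw [key, ← map_pow ι.symm, inv_pow]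

end Satake

/-! ## Compatibility at `v` gives compatibility of the restriction at `w ∣ v` -/

section Compatible

variable {n : ℕ} {K : Type} [Field K] [NumberField K] {L : Type} [Field L] [NumberField L]
  [Algebra K L] {hK : isCompact_glFiniteIntegralLevel n K}
  {hL : isCompact_glFiniteIntegralLevel n L}
  {ℓ : ℕ} [Fact ℓ.Prime]

/-- **Restriction to `Γ_L` at a place `w ∣ v`**: if `r : Γ_K → GL_n(ℚ̄_ℓ)` is unramified at `v`
with arithmetic-Frobenius characteristic polynomial `arithFrobPolyOfSatake ı q_v m α`, then
`r|_{Γ_L}` is unramified at `w` with arithmetic-Frobenius characteristic polynomial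
`arithFrobPolyOfSatake ı q_w m (α^{f(w|v)})` (`q_w = q_v^{f(w|v)}`,
`residueCard_eq_residueCard_pow_inertiaDeg`; `FramedGaloisRep.isUnramifiedAt_restrictField`,
`FramedGaloisRep.hasFrobCharpolyAt_restrictField`, `arithFrobPolyOfSatake_pow`).
Harris–Taylor 2001, proof of Thm. VII.1.9 (p. 230); Arthur–Clozel 1989, Ch. 3, (1.1). [folklore] -/
theorem hasFrobCharpolyAt_restrictField_arithFrobPolyOfSatake (ι : PadicAlgCl ℓ ≃+* ℂ)
    (r : GaloisRepresentations.FramedGaloisRep K (PadicAlgCl ℓ) n)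
    {v : HeightOneSpectrum (𝓞 K)} {w : HeightOneSpectrum (𝓞 L)}
    (hw : w.asIdeal.under (𝓞 K) = v.asIdeal) (hur : r.IsUnramifiedAt v) (m : ℕ) {α : Multiset ℂ}
    (hP : r.HasFrobCharpolyAt v (arithFrobPolyOfSatake ι v.residueCard m α)) :
    (r.restrictField L).IsUnramifiedAt w ∧
      (r.restrictField L).HasFrobCharpolyAt w
        (arithFrobPolyOfSatake ι w.residueCard m (α.map (· ^ w.asIdeal.inertiaDeg (𝓞 K)))) := by
  refine ⟨r.isUnramifiedAt_restrictField hw hur, ?_⟩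
  rw [GaloisRepresentations.residueCard_eq_residueCard_pow_inertiaDeg hw, arithFrobPolyOfSatake_pow,
    Multiset.map_map]
  -- `arithFrobPolyOfSatake ı q m α` is the product of `X - b` over its roots
  have hprod : arithFrobPolyOfSatake ι v.residueCard m α =
      ((arithFrobPolyOfSatake ι v.residueCard m α).roots.map fun b ↦ X - C b).prod := by
    rw [roots_arithFrobPolyOfSatake, arithFrobPolyOfSatake, Multiset.map_map]
    rfl
  have hP' : r.HasFrobCharpolyAt v
      (((arithFrobPolyOfSatake ι v.residueCard m α).roots.map fun b ↦ X - C b).prod) := by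
    rwa [← hprod]
  exact r.hasFrobCharpolyAt_restrictField hw hur hP'

/-- **Unramified compatibility passes to the restriction along a base change.**  Let `π` be an
automorphic representation of `GL_n(𝔸_K)` with Satake parameter `α` at `v`, compatible at `v`
with `r : Γ_K → GL_n(ℚ̄_ℓ)` (`IsGaloisCompatibleAt π ı r v`), and let `Π` be an automorphic
representation of `GL_n(𝔸_L)`, `L ⊇ K`, with Satake parameter `α^{f(w|v)}` at the place
`w ∣ v` — Arthur–Clozel's relation `c(Π_w) = c(π_v)^{f(w|v)}` for a base-change lift (Ch. 3,
(1.1); the tree's `exists_baseChange_cyclic`).  Then `r|_{Γ_L}` is compatible with `Π` at `w`: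
the Satake parameter of `Π` at `w` is unique (`AutomorphicRepData.hasSatakeParamAt_unique_holds`)
and `hasFrobCharpolyAt_restrictField_arithFrobPolyOfSatake` applies.  This is the Frobenius
bookkeeping behind "`[R_l(Res Π)] = [R_l(Π)|_{Gal(F^ac/F')}]` by the Cebotarev density theorem"
in the proof of Harris–Taylor's Thm. VII.1.9 (p. 230), i.e. of Harris–Lan–Taylor–Thorne's
Cor. 7.14 (p. 232). [folklore] -/
theorem isGaloisCompatibleAt_restrictField (π : AutomorphicRepData (AutomorphyDatum.gl n K hK))
    (P : AutomorphicRepData (AutomorphyDatum.gl n L hL)) (ι : PadicAlgCl ℓ ≃+* ℂ)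
    (r : GaloisRepresentations.FramedGaloisRep K (PadicAlgCl ℓ) n)
    {v : HeightOneSpectrum (𝓞 K)} {w : HeightOneSpectrum (𝓞 L)}
    (hw : w.asIdeal.under (𝓞 K) = v.asIdeal) {α : Multiset ℂ} (hα : π.HasSatakeParamAt v α)
    (hP : P.HasSatakeParamAt w (α.map (· ^ w.asIdeal.inertiaDeg (𝓞 K))))
    (h : IsGaloisCompatibleAt π ι r v) :
    IsGaloisCompatibleAt P ι (r.restrictField L) w := by
  intro β hβ
  obtain rfl : β = α.map (· ^ w.asIdeal.inertiaDeg (𝓞 K)) :=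
    P.hasSatakeParamAt_unique_holds hβ hP
  obtain ⟨hur, hch⟩ := h α hα
  exact (hasFrobCharpolyAt_restrictField_arithFrobPolyOfSatake ι r hw hur n hch)

end Compatible

end Literature.NumberTheory.Automorphic
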